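import Literature.AlgebraicGeometry.Motives.HodgeThetaAnnihilatorTimesGluedBlocks
import Literature.AlgebraicGeometry.HodgeTheory.TimesLowGenericInvariance
import HarnessLib

/-!
# Hodge classes on abelian varieties with slots over `A × S`, `S` with glued `𝔰𝔩₂`-blocks on `H¹(S) ⊗ ℂ` (real or quaternionic multiplication), `Hom(A, S) = 0`: the invariance theorem — the coefficient tensor is killed by the circle `Θ_A ⊕ 0` (Moonen–Zarhin 1999 Lemma (3.4) with (2.2)/(2.4), Lie step)

Family `hodge`, layer `Literature/AlgebraicGeometry/HodgeTheory`. Research context: cell `pub-hodge-ring2`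
(HONEST FRAMING: research route conditional on HC_CM; not a corollary; Q11.4-sentence-2 already refuted in
dim ≥ 3), Literature lane, programme R25 («`X × S` for `S` a simple abelian surface with real multiplication by a
real quadratic field (type I(2)) or with quaternionic multiplication (type II(1)), and ANY `X` with `Hom(X, S) = 0`»
— the last non-simple fourfold rows `S' × S` of Moonen–Zarhin's Thm. 0.1 (4) outside case (a) that the tree
lacked). UNCONDITIONAL (the Betti hypotheses are the tree theorems `exists_isReal_hodgeModel_holds`,
`hodgePQ_independent_of_hodgeModel_holds`, `hodgeTensorFacts_holds`); theorems only, no definition, no named fact;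
no step towards a summit statement. This file is the COMPANION of `TimesLowGenericInvariance` (programme R23:
`End⁰(S) = ℚ`, `dim S ≤ 3`) with the Lie step
`HodgeStructure.wordDerAt_incl_proj_theta_eq_zero_of_times_lowRankGeneric` replaced by
`HodgeStructure.wordDerAt_incl_proj_theta_eq_zero_of_times_gluedBlocks`
(`Motives/HodgeThetaAnnihilatorTimesGluedBlocks`: the graph of Moonen–Zarhin's (3.1) is excluded for a second
factor whose admissible algebras are glued `⊕_{classes} 𝔰𝔩₂` by «the standard representation of one block is the
only length-one representation», proved there in elementary form), so that `End⁰(S) = ℚ` becomes: `H¹(S) ⊗ ℂ`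
carries an internal decomposition into two-dimensional blocks `T_k` such that (GLUED) for every polarization and
Hodge operator there are glued Hodge-adapted block bases and an idempotent class map with the three properties of
the tree's `GluedBlocks.exists_glued_adapted_blockBasis` for EVERY admissible algebra, (BLOCKS) rational operators
commuting with `End_Hdg(H¹ S)` preserve the blocks, (QS) non-zero such operators are non-zero on every block —
hypotheses discharged in `TimesGluedBlocksProductSpan` for simple abelian surfaces of types I(2) and II(1) by the
tree's bridges `exists_glued_adapted_blockBasis_of_isMurtyTypeWith_one` (V. K. Murty 1988 Thm. 2, `m = 1`) and
`exists_glued_adapted_blockBasis_of_realSplitting` (Moonen–Zarhin (2.2) Type 2(1)).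

PRINTED RESULT. B. Moonen, Yu. G. Zarhin, *Hodge classes on abelian varieties of low dimension*, Math. Ann.
**315** (1999) 711–733, Lemma (3.4) [held `paper:arxiv-math_9901113`, chunk p0006 L133–L140, p0007 L1–L8]:
«Let `X₁` and `X₂` be nonzero complex abelian varieties. Write `X = X₁ × X₂`. Assume that `hg(X₂)` is a `ℚ`-simple
Lie algebra of non-compact type and that, up to isomorphism, `V_{X₂}` is the only irreducible `hg(X₂)`-module which
is a length 1 representation of non-compact type. Then either `Hg(X) = Hg(X₁) × Hg(X₂)` or `Hom(X₂, X₁) ≠ 0`»;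
(2.2) [chunk p0005]: Type 1(2) «`Hg(X) = R_{F/ℚ} SL_{2,F}`», Type 2(1) «`D = End⁰(X)` is a quaternion algebra over
`ℚ`, split at `∞` … `Hg(X) = U_{D^opp}`»; (2.4)(3) [chunk p0005 L113–L124]: «Suppose `X` is not of CM-type. Then
`Hg(X)` is a `ℚ`-simple algebraic group, except when `dim(X) = 3` and `End⁰(X)` is an imaginary quadratic field. If
`Hg(X)` is `ℚ`-simple then (up to isomorphism) there is exactly one faithful irreducible representation of `hg(X)`
over `ℚ` which is of length 1»; used in §5 (5.4) [chunk p0009]: «If `dim(X₂) < 3` then the desired equality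
`Hg(X) = Hg(X₁) × Hg(X₂)` follows from (2.4) and (3.4)». With (3.1): the Hodge ring of every `X₁^m × X₂^n` is then
generated by the classes coming from the factors. This file is the LIE STEP on tensors: the tensor invariants of
`Hg(A × S)` are invariant under the circle `Θ_A ⊕ 0`.

MAIN RESULT. `AVSlots.exists_coeff_eq_zero_off_balanced_of_prod_gluedBlocks`: the statement of the companion's
`AVSlots.exists_coeff_eq_zero_off_balanced_of_prod_lowGeneric` VERBATIM with the hypotheses `0 < dim S ≤ 3`,
`finrank_ℚ End⁰(S) = 1` replaced by the glued-block data (GLUED), (BLOCKS), (QS) on `H¹(S) ⊗ ℂ` (Hodge form of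
the remaining hypothesis: no non-zero `IsHodgeMorphismOne A S ψ`; from «`Hom(A, S) = 0`» by the tree's
`forall_isHodgeMorphismOne_eq_zero_of_forall_hom_eq_zero`, Deligne–Milne 6.20).

PROOF = the companion's proof with its inputs for `H¹(S)` replaced: a polarization `ψ_S` and a Hodge operator
`Θ_S` of `H¹(S)`, the glued data `(cls, b')` of (GLUED) at `(ψ_S, Θ_S)`, and `Hom_Hdg = 0` transported to the
Hodge pieces; then, verbatim: kind-balanced antisymmetric coefficients, base change to rational letters,
`Θ ∈ 𝔞_ℂ`, the Lie step, transport back to the adapted letters, where `ι₁ Θ_A π₁` is `diag(1, -1)` at the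
`A`-places and `0` at the `S`-places.

## References

* [MoonenZarhin1999LowDim] B. Moonen, Yu. Zarhin, Math. Ann. 315 (1999), §2 (2.2), (2.4), §3 (3.1), Lemma (3.4),
  §5 (5.4)–(5.5). [cite: MoonenZarhin1999LowDim, §3 Lemma (3.4)]
* [Hazama1983] F. Hazama, Tôhoku Math. J. 35 (1983), §3 pp. 305–306. [cite: Hazama1983, §3 (pp. 305–306)]
* [Murty1988] V. Kumar Murty, Proc. AMS 104 (1988), Thm. 2 (p. 67). [cite: Murty1988, Thm. 2 (p. 67)]
* [Deligne1982HodgeCycles] P. Deligne, LNM 900 (1982), I §3 Prop. 3.4, Prop. 3.6. [cite: Deligne1982HodgeCycles, I §3 Prop. 3.4]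
* [DeligneMilne1982Tannakian] P. Deligne, J. S. Milne, LNM 900 (1982), §6 Thm. 6.20 (Riemann). [cite: DeligneMilne1982Tannakian, §6 Thm. 6.20]
* [VoisinHodgeI2002] C. Voisin, *Hodge Theory I*, §7.1.1, §7.3.2, §11.3.3 Thm. 11.38. [cite: VoisinHodgeI2002, §7.3.2]
* [GoodmanWallachGTM255] R. Goodman, N. R. Wallach, GTM 255, §4.1.1. [cite: GoodmanWallachGTM255, §4.1.1]
-/

noncomputable section

open scoped TensorProduct
open CategoryTheory Module

namespace Literature.AlgebraicGeometry.HodgeTheory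

open Literature.AlgebraicTopology.SingularHomology
open Literature.AlgebraicGeometry.Motives (IsSmoothProjective AbelianVariety bettiCohomology
  ofRatClassBaseChange ofRatClassBaseChange_tmul HodgeTensorFacts hodgeTensorFacts_holds)
open Literature.Barriers.HodgeConjecture
open Literature.AlgebraicGeometry.Motives.HodgeStructure
open Literature.AlgebraicGeometry.ComplexMultiplication
open Literature.RepresentationTheory.GeneralLinear
open Literature.NumberTheory.DiophantineGeometry

section Invariance

variable {A S X : AbelianVariety ℂ} {n : ℕ} {g : Fin n → (X ⟶ A.prod S)}

/-- The two elements of `Fin 2`. [folklore] -/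
private theorem fin2_eq_zero_or_one_glued (r : Fin 2) : r = 0 ∨ r = 1 := by
  fin_cases r <;> simp

open scoped Classical in
/-- **The INVARIANCE THEOREM for slots over `A × S`, `S` an abelian variety whose `H¹(S) ⊗ ℂ` carries glued
`𝔰𝔩₂`-blocks and `Hom_Hdg(H¹(S), H¹(A)) = 0` (Moonen–Zarhin 1999 Lemma (3.4) with (2.2), (2.4) and (3.1), Lie step;
Hazama 1983 §3; V. K. Murty 1988 Thm. 2).** Let `H¹(S) ⊗ ℂ = ⊕_{k ∈ κ} T_k` (`κ ≠ ∅`) be an internal decomposition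
such that (BLOCKS) every rational operator commuting with `End_Hdg(H¹ S)` preserves the `T_k`, (GLUED) for every
polarization `ψ` and Hodge operator `Θ` of `H¹(S)` there are an idempotent class map `cls` and `Θ`-adapted block
bases `b'` with, for EVERY bracket-closed rational `ψ`-skew `𝔤 ∋_ℂ Θ` commuting with `End_Hdg(H¹ S)`: trace-free
blocks, equal blocks along classes, every class operator in `𝔤_ℂ` (the output of the tree's
`exists_glued_adapted_blockBasis_of_isMurtyTypeWith_one` / `…_of_realSplitting`), (QS) every non-zero rational
operator commuting with `End_Hdg(H¹ S)` is non-zero on every block; let no non-zero `ℚ`-linear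
`H¹(S(ℂ); ℚ) → H¹(A(ℂ); ℚ)` be a morphism of Hodge structures (`IsHodgeMorphismOne`; «`Hom(A, S) = 0`» by
`forall_isHodgeMorphismOne_eq_zero_of_forall_hom_eq_zero`), and let `X` be an abelian variety with slots `g` over
`A × S`. Then there are Hodge-adapted pair bases `(b_i^0, b_i^1)_{i < h_A}` of `H¹(A) ⊗ ℂ` and `(c_i^0, c_i^1)_{i < h_S}`
of `H¹(S) ⊗ ℂ` such that every rational class `c` of type `(p,p)` on `X` (`p ≥ 1`) is `∑_w a(w) · x_w` in the letters
`x((j, inl i), r) = g_j^* pr_A^* b_i^r`, `x((j, inr i), r) = g_j^* pr_S^* c_i^r`, for a coefficient function `a` that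
VANISHES at every slot-and-place word `U` and kind word `η` whose `A`-letters are not kind-balanced — the tensor
invariants of `X` are invariants of `Θ_A ⊕ 0 ∈ hg(A) ⊕ hg(S) = hg(A × S)` («Assume that `hg(X₂)` is a `ℚ`-simple Lie
algebra of non-compact type and that, up to isomorphism, `V_{X₂}` is the only irreducible `hg(X₂)`-module which is a
length 1 representation of non-compact type. Then either `Hg(X) = Hg(X₁) × Hg(X₂)` or `Hom(X₂, X₁) ≠ 0`»; for a simple
abelian surface of type I(2) or II(1) the hypothesis holds by (2.2)/(2.4)). The statement is that of the tree's
`AVSlots.exists_coeff_eq_zero_off_balanced_of_prod_lowGeneric` VERBATIM with the generic hypotheses replaced by the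
glued data; the Lie step is `HodgeStructure.wordDerAt_incl_proj_theta_eq_zero_of_times_gluedBlocks`.
[cite: MoonenZarhin1999LowDim, §2 (2.2), (2.4), §3 (3.1) and Lemma (3.4), §5 (5.4)] [cite: Hazama1983, §3 (pp. 305–306)]
[cite: Murty1988, Thm. 2 (p. 67)] [cite: Deligne1982HodgeCycles, I §3 Prop. 3.4] [cite: DeligneMilne1982Tannakian, §6 Thm. 6.20] -/
theorem AVSlots.exists_coeff_eq_zero_off_balanced_of_prod_gluedBlocks (hg : AVSlots (A.prod S) X g)
    {κ : Type} [Fintype κ] [DecidableEq κ] [Nonempty κ] {T : κ → Submodule ℂ (ℂ ⊗[ℚ] bettiCohomology S.X 1)}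
    (hint : DirectSum.IsInternal T)
    (hTE : ∀ (hHD : exists_isReal_hodgeModel) (hI : hodgePQ_independent_of_hodgeModel)
      (Y : Module.End ℚ (bettiCohomology S.X 1)),
      (∀ a : (BettiUniverse.hodge hHD (AbelianVariety.isSmoothProjective_holds (A := S)) 1).endAlg,
        Y * (a : Module.End ℚ (bettiCohomology S.X 1)) = (a : Module.End ℚ (bettiCohomology S.X 1)) * Y) →
      ∀ k, Set.MapsTo (Y.baseChange ℂ) (T k) (T k))
    (hS : ∀ (hHD : exists_isReal_hodgeModel) (hI : hodgePQ_independent_of_hodgeModel)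
      (ψ : (BettiUniverse.hodge hHD (AbelianVariety.isSmoothProjective_holds (A := S)) 1).Polarization)
      {Θ : Module.End ℂ (ℂ ⊗[ℚ] bettiCohomology S.X 1)},
      (∀ p, ∀ x ∈ (BettiUniverse.hodge hHD (AbelianVariety.isSmoothProjective_holds (A := S)) 1).piece p
        (((1 : ℕ) : ℤ) - p), Θ x = ((2 * p - ((1 : ℕ) : ℤ) : ℤ) : ℂ) • x) →
      ∃ (cls : κ → κ) (b' : ∀ k, Module.Basis (Fin 2) ℂ (T k)),
        (∀ k, (b' k 0 : ℂ ⊗[ℚ] bettiCohomology S.X 1) ∈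
          (BettiUniverse.hodge hHD (AbelianVariety.isSmoothProjective_holds (A := S)) 1).piece 1 0) ∧
        (∀ k, (b' k 1 : ℂ ⊗[ℚ] bettiCohomology S.X 1) ∈
          (BettiUniverse.hodge hHD (AbelianVariety.isSmoothProjective_holds (A := S)) 1).piece 0 1) ∧
        (∀ k, cls (cls k) = cls k) ∧
        ∀ 𝔤 : Submodule ℚ (Module.End ℚ (bettiCohomology S.X 1)),
          (∀ Y ∈ 𝔤, ∀ Y' ∈ 𝔤, Y * Y' - Y' * Y ∈ 𝔤) → Θ ∈ spanC 𝔤 →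
          (∀ Y ∈ 𝔤, ∀ a : (BettiUniverse.hodge hHD (AbelianVariety.isSmoothProjective_holds (A := S)) 1).endAlg,
            Y * (a : Module.End ℚ (bettiCohomology S.X 1)) = (a : Module.End ℚ (bettiCohomology S.X 1)) * Y) →
          (∀ Y ∈ 𝔤, ∀ v w, ψ.form (Y v) w + ψ.form v (Y w) = 0) →
          (∀ Y ∈ spanC 𝔤, ∀ k, (RealPlaces.blockMat hint b' Y k).trace = 0) ∧
          (∀ Y ∈ spanC 𝔤, ∀ k k', cls k = cls k' → RealPlaces.blockMat hint b' Y k = RealPlaces.blockMat hint b' Y k') ∧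
          (∀ (k₀ : κ) (N : Matrix (Fin 2) (Fin 2) ℂ), N.trace = 0 →
            RealPlaces.assemble hint b' (fun k => if cls k = cls k₀ then N else 0) ∈ spanC 𝔤))
    (hqs : ∀ (hHD : exists_isReal_hodgeModel) (hI : hodgePQ_independent_of_hodgeModel)
      (Y : Module.End ℚ (bettiCohomology S.X 1)),
      (∀ a : (BettiUniverse.hodge hHD (AbelianVariety.isSmoothProjective_holds (A := S)) 1).endAlg,
        Y * (a : Module.End ℚ (bettiCohomology S.X 1)) = (a : Module.End ℚ (bettiCohomology S.X 1)) * Y) →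
      Y ≠ 0 → ∀ k, ∃ x ∈ T k, Y.baseChange ℂ x ≠ 0)
    (hHom : ∀ ψ : bettiCohomology S.X 1 →ₗ[ℚ] bettiCohomology A.X 1, IsHodgeMorphismOne A S ψ → ψ = 0) :
    ∃ (hA : ℕ) (bA : Module.Basis (Fin hA × Fin 2) ℂ (ℂ ⊗[ℚ] bettiCohomology A.X 1))
      (h : ℕ) (cS : Module.Basis (Fin h × Fin 2) ℂ (ℂ ⊗[ℚ] bettiCohomology S.X 1)),
      (∀ i, IsOfHodgeType A.dim A.X 1 1 0 (ofRatClassBaseChange (Motives.ComplexPoints A.X) 1 (bA (i, 0)))) ∧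
      (∀ i, IsOfHodgeType A.dim A.X 1 0 1 (ofRatClassBaseChange (Motives.ComplexPoints A.X) 1 (bA (i, 1)))) ∧
      (∀ i, IsOfHodgeType S.dim S.X 1 1 0 (ofRatClassBaseChange (Motives.ComplexPoints S.X) 1 (cS (i, 0)))) ∧
      (∀ i, IsOfHodgeType S.dim S.X 1 0 1 (ofRatClassBaseChange (Motives.ComplexPoints S.X) 1 (cS (i, 1)))) ∧
      ∀ {p : ℕ}, 0 < p → ∀ {c : complexBetti X.X (2 * p)}, IsRationalClass c →
        IsOfHodgeType X.dim X.X (2 * p) p p c →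
        ∃ a : (Fin (2 * p) → (Fin n × (Fin hA ⊕ Fin h)) × Fin 2) → ℂ,
          wordEval (cupPowOneAlt ℂ (Motives.ComplexPoints X.X) (2 * p))
            (fun jr : (Fin n × (Fin hA ⊕ Fin h)) × Fin 2 => complexBetti.map (g jr.1.1).hom.hom.hom 1
              (Sum.elim
                (fun i => complexBetti.map (Motives.AbelianVariety.fst A S).hom.hom.hom 1
                  (ofRatClassBaseChange (Motives.ComplexPoints A.X) 1 (bA (i, jr.2))))
                (fun i => complexBetti.map (Motives.AbelianVariety.snd A S).hom.hom.hom 1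
                  (ofRatClassBaseChange (Motives.ComplexPoints S.X) 1 (cS (i, jr.2))))
                jr.1.2)) a = c ∧
          ∀ (U : Fin (2 * p) → Fin n × (Fin hA ⊕ Fin h)) (η : Fin (2 * p) → Fin 2),
            (∑ t, Sum.elim (fun _ : Fin hA => if η t = 0 then (1 : ℂ) else -1) (fun _ : Fin h => (0 : ℂ)) (U t).2) ≠ 0 →
            a (fun t => (U t, η t)) = 0 := by
  classical
  -- the setting
  have hHD : exists_isReal_hodgeModel := exists_isReal_hodgeModel_holds
  have hI : hodgePQ_independent_of_hodgeModel := hodgePQ_independent_of_hodgeModel_holds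
  haveI : HodgeTensorFacts.{0, 0} := hodgeTensorFacts_holds.{0, 0}
  have hXA : IsSmoothProjective A.dim A.X := AbelianVariety.isSmoothProjective_holds
  have hXS : IsSmoothProjective S.dim S.X := AbelianVariety.isSmoothProjective_holds
  have hXP : IsSmoothProjective (A.prod S).dim (A.prod S).X := AbelianVariety.isSmoothProjective_holds
  haveI : Module.Finite ℚ (bettiCohomology A.X 1) := finite_bettiCohomology_one A
  haveI : Module.Finite ℚ (bettiCohomology S.X 1) := finite_bettiCohomology_one S
  haveI : Module.Finite ℚ (bettiCohomology (A.prod S).X 1) := finite_bettiCohomology_one (A.prod S)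
  have hn1 : (((1 : ℕ) : ℤ)) = 1 := by norm_num
  -- the pair bases of `H¹(A) ⊗ ℂ` and `H¹(S) ⊗ ℂ`
  obtain ⟨hA, bA, hbA0, hbA1⟩ := exists_hodgeAdapted_pairBasis (BettiUniverse.hodge hHD hXA 1) (by norm_num)
    (BettiUniverse.hodge_isEffective hHD hXA 1)
  have hbA0' : ∀ i, bA (i, 0) ∈ (BettiUniverse.hodge hHD hXA 1).piece 1 0 := fun i => by simpa using hbA0 i
  have hbA1' : ∀ i, bA (i, 1) ∈ (BettiUniverse.hodge hHD hXA 1).piece 0 1 := fun i => by simpa using hbA1 i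
  obtain ⟨h, cS, hcS0, hcS1⟩ := exists_hodgeAdapted_pairBasis (BettiUniverse.hodge hHD hXS 1) (by norm_num)
    (BettiUniverse.hodge_isEffective hHD hXS 1)
  have hcS0' : ∀ i, cS (i, 0) ∈ (BettiUniverse.hodge hHD hXS 1).piece 1 0 := fun i => by simpa using hcS0 i
  have hcS1' : ∀ i, cS (i, 1) ∈ (BettiUniverse.hodge hHD hXS 1).piece 0 1 := fun i => by simpa using hcS1 i
  refine ⟨hA, bA, h, cS, fun i => ?_, fun i => ?_, fun i => ?_, fun i => ?_, ?_⟩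
  · exact (BettiUniverse.mem_hodge_piece_iff hHD hI hXA (k := 1) (p := 1) (q := 0) rfl _).1 (hbA0' i)
  · exact (BettiUniverse.mem_hodge_piece_iff hHD hI hXA (k := 1) (p := 0) (q := 1) rfl _).1 (hbA1' i)
  · exact (BettiUniverse.mem_hodge_piece_iff hHD hI hXS (k := 1) (p := 1) (q := 0) rfl _).1 (hcS0' i)
  · exact (BettiUniverse.mem_hodge_piece_iff hHD hI hXS (k := 1) (p := 0) (q := 1) rfl _).1 (hcS1' i)
  intro p hp c hcQ hc
  -- the presentation `H¹(A × S) = pr_A^* H¹(A) ⊕ pr_C^* H¹(S)` and its complexification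
  set ι₁ := HOneProduct.pullFst A S with hι₁
  set π₁ := HOneProduct.pullInl A S with hπ₁
  set ι₂ := HOneProduct.pullSnd A S with hι₂
  set π₂ := HOneProduct.pullInr A S with hπ₂
  have hπι₁ : π₁ ∘ₗ ι₁ = LinearMap.id := HOneProduct.pullInl_comp_pullFst
  have hπι₂ : π₂ ∘ₗ ι₂ = LinearMap.id := HOneProduct.pullInr_comp_pullSnd
  have hπ₁ι₂ : π₁ ∘ₗ ι₂ = 0 := HOneProduct.pullInl_comp_pullSnd
  have hπ₂ι₁ : π₂ ∘ₗ ι₁ = 0 := HOneProduct.pullInr_comp_pullFst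
  have hsum : ι₁ ∘ₗ π₁ + ι₂ ∘ₗ π₂ = LinearMap.id := HOneProduct.pullFst_comp_pullInl_add
  have hπι₁C : π₁.baseChange ℂ ∘ₗ ι₁.baseChange ℂ = LinearMap.id := by
    rw [← LinearMap.baseChange_comp, hπι₁, LinearMap.baseChange_id]
  have hπι₂C : π₂.baseChange ℂ ∘ₗ ι₂.baseChange ℂ = LinearMap.id := by
    rw [← LinearMap.baseChange_comp, hπι₂, LinearMap.baseChange_id]
  have hπ₁ι₂C : π₁.baseChange ℂ ∘ₗ ι₂.baseChange ℂ = 0 := by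
    rw [← LinearMap.baseChange_comp, hπ₁ι₂, LinearMap.baseChange_zero]
  have hπ₂ι₁C : π₂.baseChange ℂ ∘ₗ ι₁.baseChange ℂ = 0 := by
    rw [← LinearMap.baseChange_comp, hπ₂ι₁, LinearMap.baseChange_zero]
  have hsumC : ι₁.baseChange ℂ ∘ₗ π₁.baseChange ℂ + ι₂.baseChange ℂ ∘ₗ π₂.baseChange ℂ = LinearMap.id := by
    rw [← LinearMap.baseChange_comp, ← LinearMap.baseChange_comp, ← LinearMap.baseChange_add, hsum,
      LinearMap.baseChange_id]
  -- piece compatibility of `pr_A^*`, `pr_C^*` (pull-backs are morphisms of Hodge structures)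
  have hι₁F : ∀ q : ℤ, ∀ x ∈ (BettiUniverse.hodge hHD hXA 1).piece q (((1 : ℕ) : ℤ) - q), ι₁.baseChange ℂ x ∈ (BettiUniverse.hodge hHD hXP 1).piece q (((1 : ℕ) : ℤ) - q) :=
    fun q x hx => (BettiUniverse.pullHodgeHom hHD hI hXP hXA (Motives.AbelianVariety.fst A S).hom.hom.hom 1).map_piece_le
      q _ ⟨x, hx, rfl⟩
  have hι₂F : ∀ q : ℤ, ∀ x ∈ (BettiUniverse.hodge hHD hXS 1).piece q (((1 : ℕ) : ℤ) - q), ι₂.baseChange ℂ x ∈ (BettiUniverse.hodge hHD hXP 1).piece q (((1 : ℕ) : ℤ) - q) :=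
    fun q x hx => (BettiUniverse.pullHodgeHom hHD hI hXP hXS (Motives.AbelianVariety.snd A S).hom.hom.hom 1).map_piece_le
      q _ ⟨x, hx, rfl⟩
  -- §1: the basis `cbx` of `H¹(A × S) ⊗ ℂ` in pairs: `pr_A^* b_i^r` and `pr_C^* c_i^r`
  obtain ⟨cbx', hcbx'l, hcbx'r⟩ := exists_basis_of_presentation hπι₁C hπι₂C hπ₁ι₂C hπ₂ι₁C hsumC bA cS
  set cbx : Module.Basis ((Fin hA ⊕ Fin h) × Fin 2) ℂ (ℂ ⊗[ℚ] bettiCohomology (A.prod S).X 1) :=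
    cbx'.reindex (Equiv.sumProdDistrib (Fin hA) (Fin h) (Fin 2)).symm with hcbxdef
  have hcbx : ∀ tr : (Fin hA ⊕ Fin h) × Fin 2, cbx tr =
      Sum.elim (fun i => ι₁.baseChange ℂ (bA (i, tr.2))) (fun i => ι₂.baseChange ℂ (cS (i, tr.2))) tr.1 := by
    rintro ⟨t, r⟩
    rw [hcbxdef, Module.Basis.reindex_apply, Equiv.symm_symm]
    rcases t with i | i
    · rw [Equiv.sumProdDistrib_apply_left, hcbx'l]; rfl
    · rw [Equiv.sumProdDistrib_apply_right, hcbx'r]; rfl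
  -- Hodge-adaptedness of `cbx`
  have hcbx0 : ∀ t, cbx (t, 0) ∈ (BettiUniverse.hodge hHD hXP 1).piece 1 0 := by
    intro t
    rw [hcbx]
    rcases t with i | i
    · exact hι₁F 1 _ (by simpa using hbA0' i)
    · exact hι₂F 1 _ (by simpa using hcS0' i)
  have hcbx1 : ∀ t, cbx (t, 1) ∈ (BettiUniverse.hodge hHD hXP 1).piece 0 1 := by
    intro t
    rw [hcbx]
    rcases t with i | i
    · have e : (((1 : ℕ) : ℤ) - 0) = 1 := by norm_num
      have h01 := hι₁F 0 _ (by rw [e]; exact hbA1' i)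
      rwa [e] at h01
    · have e : (((1 : ℕ) : ℤ) - 0) = 1 := by norm_num
      have h01 := hι₂F 0 _ (by rw [e]; exact hcS1' i)
      rwa [e] at h01
  -- bases indexed by `Fin M`: the pair basis `cbσ` and the rational basis `eC`
  set eQ := Module.finBasis ℚ (bettiCohomology (A.prod S).X 1) with heQ
  set eC : Module.Basis (Fin (Module.finrank ℚ (bettiCohomology (A.prod S).X 1))) ℂ
    (ℂ ⊗[ℚ] bettiCohomology (A.prod S).X 1) := Algebra.TensorProduct.basis ℂ eQ with heC
  set φ : Fin (Module.finrank ℚ (bettiCohomology (A.prod S).X 1)) ≃ (Fin hA ⊕ Fin h) × Fin 2 :=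
    eC.indexEquiv cbx with hφ
  set cbσ : Module.Basis (Fin (Module.finrank ℚ (bettiCohomology (A.prod S).X 1))) ℂ
    (ℂ ⊗[ℚ] bettiCohomology (A.prod S).X 1) := cbx.reindex φ.symm with hcbσdef
  have hcbσ : ∀ m, cbσ m = cbx (φ m) := fun m => by
    rw [hcbσdef, Module.Basis.reindex_apply, Equiv.symm_symm]
  -- letters
  set ρ := ofRatClassBaseChangeEquiv hXP 1 with hρ
  set v : Module.Basis _ ℂ (complexBetti (A.prod S).X 1) := cbσ.map ρ with hv
  set eL : Module.Basis _ ℂ (complexBetti (A.prod S).X 1) := eC.map ρ with heL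
  have heLQ : ∀ i, IsRationalClass (eL i) := fun i => by
    rw [heL, Module.Basis.map_apply, heC, Algebra.TensorProduct.basis_apply, hρ,
      ofRatClassBaseChangeEquiv_apply, ofRatClassBaseChange_tmul, one_smul]
    exact isRationalClass_ofRatClass _
  set κ : Fin (Module.finrank ℚ (bettiCohomology (A.prod S).X 1)) → Fin 2 := fun m => (φ m).2 with hκ
  have hv_apply : ∀ m, v m = ofRatClassBaseChange (Motives.ComplexPoints (A.prod S).X) 1 (cbx (φ m)) := fun m => by
    rw [hv, Module.Basis.map_apply, hcbσ, hρ, ofRatClassBaseChangeEquiv_apply]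
  have hv0 : ∀ m, κ m = 0 → IsOfHodgeType (A.prod S).dim (A.prod S).X 1 1 0 (v m) := by
    intro m hm
    rw [hv_apply, ← BettiUniverse.mem_hodge_piece_iff hHD hI hXP (k := 1) (p := 1) (q := 0) rfl]
    have hsplit : φ m = ((φ m).1, 0) := by
      change (φ m).2 = 0 at hm; rw [← hm]
    rw [hsplit]
    exact hcbx0 _
  have hv1 : ∀ m, κ m = 1 → IsOfHodgeType (A.prod S).dim (A.prod S).X 1 0 1 (v m) := by
    intro m hm
    rw [hv_apply, ← BettiUniverse.mem_hodge_piece_iff hHD hI hXP (k := 1) (p := 0) (q := 1) rfl]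
    have hsplit : φ m = ((φ m).1, 1) := by
      change (φ m).2 = 1 at hm; rw [← hm]
    rw [hsplit]
    exact hcbx1 _
  -- (α) an antisymmetric kind-balanced coefficient function in the adapted letters
  obtain ⟨ax, hax_bal, hax_anti, hcax⟩ := hg.exists_antisymm_kindBalanced_wordEval_eq v κ hv0 hv1 hp hc
  -- the change of letters to the rational letters
  set G : Matrix _ _ ℂ := eC.toMatrix cbσ with hG
  set G' : Matrix _ _ ℂ := cbσ.toMatrix eC with hG'
  have hG'G : G' * G = 1 := cbσ.toMatrix_mul_toMatrix_flip eC
  have hve : ∀ m, v m = ∑ i, G i m • eL i := fun m => by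
    simp only [hv, heL, Module.Basis.map_apply, ← map_smul, ← map_sum]
    congr 1
    exact (eC.sum_toMatrix_smul_self (v := ⇑cbσ) (j := m)).symm
  have hletters : ∀ j m, avLetters g v (j, m) = ∑ i, G i m • avLetters g eL (j, i) :=
    avLetters_baseChange g G hve
  set aE := colourChangeAt (fun _ : Fin n => G) ax with haE
  have haE_anti : IsAntisymm aE := hax_anti.colourChangeAt _
  have hcaE : wordEval (cupPowOneAlt ℂ (Motives.ComplexPoints X.X) (2 * p)) (avLetters g eL) aE = c := by
    rw [haE, ← wordEval_eq_wordEval_colourChangeAt _ (fun _ : Fin n => G) hletters ax, hcax]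
  -- rationality of `aE`
  have hFinj : Function.Injective (exteriorPower.alternatingMapLinearEquiv
      (cupPowOneAlt ℂ (Motives.ComplexPoints X.X) (2 * p))) :=
    injective_alternatingMapLinearEquiv_cupPowOneAlt X (2 * p)
  obtain ⟨q, hq⟩ := hg.exists_rat_wordEval_eq eL heLQ hcQ
  obtain ⟨q', -, haEq⟩ := haE_anti.exists_eq_algebraMap_of_wordEval_eq hFinj (hg.letterBasis eL)
    (q := q) (by rw [AVSlots.coe_letterBasis, hcaE, hq])
  have hslice_e : ∀ u, wordSlice aE u = wordRepAt ℂ (fun _ : Fin (2 * p) => G) (wordSlice ax u) :=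
    fun u => wordSlice_colourChangeAt (fun _ : Fin n => G) ax u
  -- the Hodge operator `Θ` of `H¹(A × S)`: `diag(±1)` in the adapted letters
  obtain ⟨Θ, hΘ⟩ := exists_hodgeTheta (BettiUniverse.hodge hHD hXP 1)
  have hΘb : ∀ m, Θ (cbσ m) = (if κ m = 0 then (1 : ℂ) else -1) • cbσ m := by
    intro m
    rw [hcbσ]
    change Θ _ = (if (φ m).2 = 0 then (1 : ℂ) else -1) • _
    rcases fin2_eq_zero_or_one_glued (φ m).2 with h0 | h1
    · rw [h0, if_pos rfl]
      have hmem : cbx (φ m) ∈ (BettiUniverse.hodge hHD hXP 1).piece 1 (((1 : ℕ) : ℤ) - 1) := by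
        have e : (((1 : ℕ) : ℤ) - 1) = 0 := by norm_num
        have hsplit : φ m = ((φ m).1, 0) := by rw [← h0]
        rw [e, hsplit]; exact hcbx0 _
      rw [hΘ 1 _ hmem]
      norm_num
    · rw [h1, if_neg one_ne_zero]
      have hmem : cbx (φ m) ∈ (BettiUniverse.hodge hHD hXP 1).piece 0 (((1 : ℕ) : ℤ) - 0) := by
        have e : (((1 : ℕ) : ℤ) - 0) = 1 := by norm_num
        have hsplit : φ m = ((φ m).1, 1) := by rw [← h1]
        rw [e, hsplit]; exact hcbx1 _
      rw [hΘ 0 _ hmem]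
      norm_num
  have hΘcb : LinearMap.toMatrix cbσ cbσ Θ = kindDiag κ := by
    ext i m
    rw [LinearMap.toMatrix_apply, hΘb, map_smul, Module.Basis.repr_self, Finsupp.smul_apply,
      Finsupp.single_apply, kindDiag, Matrix.diagonal_apply, smul_eq_mul, mul_ite, mul_one, mul_zero]
    by_cases him : i = m
    · subst him; rw [if_pos rfl]
    · rw [if_neg (Ne.symm him), if_neg him]
  have hJG : LinearMap.toMatrix eC eC Θ * G = G * kindDiag κ := by
    rw [← hΘcb, hG, linearMap_toMatrix_mul_basis_toMatrix, basis_toMatrix_mul_linearMap_toMatrix]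
  have hΘq : ∀ u : Fin (2 * p) → Fin n, wordDerAt ℂ (fun _ : Fin (2 * p) => LinearMap.toMatrix eC eC Θ)
      (wordSlice (fun w => algebraMap ℚ ℂ (q' w)) u) = 0 := by
    intro u
    rw [← haEq, hslice_e]
    refine wordDerAt_wordRepAt_eq_zero_of_mul_eq ℂ (fun _ : Fin (2 * p) => G) (fun _ => hJG) ?_
    rw [wordDerAt_const]
    exact wordDer_kindDiag_wordSlice_eq_zero κ hax_bal u
  -- polarizations, the glued data of `H¹(S)`, and `Hom_Hdg(H¹(S), H¹(A)) = 0` in piece form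
  obtain ⟨ψ⟩ : (BettiUniverse.hodge hHD (AbelianVariety.isSmoothProjective_holds (A := A)) 1).IsPolarizable :=
    smoothProjective_hodgeStructure_isPolarizable_holds hXA (BettiUniverse.realHodgeModel hHD hXA)
      (BettiUniverse.realHodgeModel_isHodgeSymmetric hHD hXA) 1
  obtain ⟨ψS⟩ : (BettiUniverse.hodge hHD (AbelianVariety.isSmoothProjective_holds (A := S)) 1).IsPolarizable :=
    smoothProjective_hodgeStructure_isPolarizable_holds hXS (BettiUniverse.realHodgeModel hHD hXS)
      (BettiUniverse.realHodgeModel_isHodgeSymmetric hHD hXS) 1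
  obtain ⟨ΘS, hΘS⟩ := exists_hodgeTheta (BettiUniverse.hodge hHD hXS 1)
  obtain ⟨cls, b', hb0, hb1, hcls, hall⟩ := hS hHD hI ψS hΘS
  have hb0' : ∀ k, (b' k 0 : ℂ ⊗[ℚ] bettiCohomology S.X 1) ∈ (BettiUniverse.hodge hHD hXS 1).piece 1 (((1 : ℕ) : ℤ) - 1) := by
    intro k
    have e : (((1 : ℕ) : ℤ) - 1) = 0 := by norm_num
    rw [e]; exact hb0 k
  have hb1' : ∀ k, (b' k 1 : ℂ ⊗[ℚ] bettiCohomology S.X 1) ∈ (BettiUniverse.hodge hHD hXS 1).piece 0 (((1 : ℕ) : ℤ) - 0) := by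
    intro k
    have e : (((1 : ℕ) : ℤ) - 0) = 1 := by norm_num
    rw [e]; exact hb1 k
  have hqs' : ∀ Y : Module.End ℚ (bettiCohomology S.X 1),
      (∀ a : (BettiUniverse.hodge hHD hXS 1).endAlg,
        Y * (a : Module.End ℚ (bettiCohomology S.X 1)) = (a : Module.End ℚ (bettiCohomology S.X 1)) * Y) →
      (∀ v w, ψS.form (Y v) w + ψS.form v (Y w) = 0) → Y ≠ 0 → ∀ k, ∃ x ∈ T k, Y.baseChange ℂ x ≠ 0 :=
    fun Y hY _ hY0 => hqs hHD hI Y hY hY0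
  have hHom' : ∀ f : bettiCohomology S.X 1 →ₗ[ℚ] bettiCohomology A.X 1,
      (∀ r : ℤ, ∀ x ∈ (BettiUniverse.hodge hHD hXS 1).piece r (((1 : ℕ) : ℤ) - r),
        f.baseChange ℂ x ∈ (BettiUniverse.hodge hHD hXA 1).piece r (((1 : ℕ) : ℤ) - r)) → f = 0 := by
    intro f hf
    refine hHom f ⟨fun x hx => ?_, fun x hx => ?_⟩
    · have hx' := (BettiUniverse.mem_hodge_piece_iff hHD hI hXS (k := 1) (p := 1) (q := 0) rfl _).2 hx
      have e : (((1 : ℕ) : ℤ) - 1) = 0 := by norm_num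
      have h := hf 1 x (by rw [e]; exact hx')
      rw [e] at h
      exact (BettiUniverse.mem_hodge_piece_iff hHD hI hXA (k := 1) (p := 1) (q := 0) rfl _).1 h
    · have hx' := (BettiUniverse.mem_hodge_piece_iff hHD hI hXS (k := 1) (p := 0) (q := 1) rfl _).2 hx
      have e : (((1 : ℕ) : ℤ) - 0) = 1 := by norm_num
      have h := hf 0 x (by rw [e]; exact hx')
      rw [e] at h
      exact (BettiUniverse.mem_hodge_piece_iff hHD hI hXA (k := 1) (p := 0) (q := 1) rfl _).1 h
  -- the Hodge operator `Θ_A` of `H¹(A)` and the partial Hodge operator `Y = pr_A^* ∘ Θ_A ∘ ι_A^*`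
  obtain ⟨ΘA, hΘA⟩ := exists_hodgeTheta (BettiUniverse.hodge hHD hXA 1)
  set Y := ι₁.baseChange ℂ ∘ₗ ΘA ∘ₗ π₁.baseChange ℂ with hY
  -- the product Lie step (Moonen–Zarhin Lemma (3.4), glued blocks): `Y` kills the rational coefficient tensor
  have hL : ∀ u : Fin (2 * p) → Fin n, wordDerAt ℂ (fun _ : Fin (2 * p) => LinearMap.toMatrix eC eC Y)
      (wordSlice (fun w => algebraMap ℚ ℂ (q' w)) u) = 0 := fun u =>
    wordDerAt_incl_proj_theta_eq_zero_of_times_gluedBlocks hn1 (BettiUniverse.hodge hHD hXP 1)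
      (BettiUniverse.hodge hHD hXA 1) (BettiUniverse.hodge hHD hXS 1) (BettiUniverse.hodge_isEffective hHD hXA 1)
      (BettiUniverse.hodge_isEffective hHD hXS 1) hπι₁ hπι₂ hπ₁ι₂ hπ₂ι₁ hsum hι₁F hι₂F ψ ψS hΘA hΘS hint b' hb0' hb1'
      cls hcls (hTE hHD hI) hall hqs' hHom' eQ q' hΘ hΘq u
  -- the diagonal weights of `Y` in the pair letters: `±1` at the `A`-places, `0` at the `S`-places
  set δ₀ : Fin hA ⊕ Fin h → Fin 2 → ℂ :=
    Sum.elim (fun (_ : Fin hA) (r : Fin 2) => if r = 0 then (1 : ℂ) else -1) (fun (_ : Fin h) (_ : Fin 2) => (0 : ℂ))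
    with hδ₀
  set D : Fin hA ⊕ Fin h → Matrix (Fin 2) (Fin 2) ℂ := fun t => Matrix.diagonal (δ₀ t) with hD
  have hYG : ∀ _t : Fin (2 * p), LinearMap.toMatrix eC eC Y * G = G * LinearMap.toMatrix cbσ cbσ Y :=
    fun _ => by rw [hG, linearMap_toMatrix_mul_basis_toMatrix, basis_toMatrix_mul_linearMap_toMatrix]
  have e11 : ∀ x, π₁.baseChange ℂ (ι₁.baseChange ℂ x) = x := fun x => by
    rw [← LinearMap.comp_apply (f := π₁.baseChange ℂ), hπι₁C, LinearMap.id_apply]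
  have e12 : ∀ y, π₁.baseChange ℂ (ι₂.baseChange ℂ y) = 0 := fun y => by
    rw [← LinearMap.comp_apply (f := π₁.baseChange ℂ), hπ₁ι₂C, LinearMap.zero_apply]
  -- `Θ_A` on the pair basis of `H¹(A) ⊗ ℂ`
  have hΘAb : ∀ (i : Fin hA) (r : Fin 2), ΘA (bA (i, r)) = (if r = 0 then (1 : ℂ) else -1) • bA (i, r) := by
    intro i r
    rcases fin2_eq_zero_or_one_glued r with h0 | h1
    · rw [h0, if_pos rfl]
      have hmem : bA (i, 0) ∈ (BettiUniverse.hodge hHD hXA 1).piece 1 (((1 : ℕ) : ℤ) - 1) := by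
        have e : (((1 : ℕ) : ℤ) - 1) = 0 := by norm_num
        rw [e]; exact hbA0' i
      rw [hΘA 1 _ hmem]
      norm_num
    · rw [h1, if_neg one_ne_zero]
      have hmem : bA (i, 1) ∈ (BettiUniverse.hodge hHD hXA 1).piece 0 (((1 : ℕ) : ℤ) - 0) := by
        have e : (((1 : ℕ) : ℤ) - 0) = 1 := by norm_num
        rw [e]; exact hbA1' i
      rw [hΘA 0 _ hmem]
      norm_num
  have hblk : LinearMap.toMatrix cbσ cbσ Y = blockLift φ D := by
    refine toMatrix_eq_blockLift_of_apply_basis φ cbσ _ Y fun m => ?_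
    rw [hcbσ m]
    have hb' : ∀ a, cbσ (φ.symm ((φ m).1, a)) = cbx ((φ m).1, a) := fun a => by
      rw [hcbσ, Equiv.apply_symm_apply]
    simp only [hb']
    obtain ⟨t, r⟩ := φ m
    rcases t with i | i
    · simp only [hcbx, Sum.elim_inl]
      rw [hY, LinearMap.comp_apply, LinearMap.comp_apply, e11, hΘAb, map_smul,
        Finset.sum_eq_single r]
      · rw [hD]
        simp only [hδ₀, Sum.elim_inl, Matrix.diagonal_apply_eq]
      · intro a _ ha
        rw [hD]
        simp only [Matrix.diagonal_apply_ne _ ha, zero_smul]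
      · intro hr; exact absurd (Finset.mem_univ r) hr
    · simp only [hcbx, Sum.elim_inr]
      rw [hY, LinearMap.comp_apply, LinearMap.comp_apply, e12, map_zero, map_zero]
      symm
      refine Finset.sum_eq_zero fun a _ => ?_
      have h0 : D (Sum.inr i) a r = 0 := by
        simp [hD, hδ₀, Matrix.diagonal_apply]
      rw [h0, zero_smul]
  -- `Y` kills the coefficient tensor in the pair letters
  have hax : ∀ u : Fin (2 * p) → Fin n, wordDerAt ℂ (fun _ : Fin (2 * p) => blockLift φ D) (wordSlice ax u) = 0 := by
    intro u
    have hLu := hL u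
    rw [← haEq, hslice_e] at hLu
    have h3 : wordRepAt ℂ (fun _ : Fin (2 * p) => G)
        (wordDerAt ℂ (fun _ : Fin (2 * p) => blockLift φ D) (wordSlice ax u)) = 0 := by
      rw [← hblk, wordRepAt_wordDerAt_of_mul_eq ℂ (fun _ : Fin (2 * p) => G) hYG, hLu]
    exact wordRepAt_injective ℂ (g := fun _ : Fin (2 * p) => G) (g' := fun _ : Fin (2 * p) => G')
      (funext fun _ => hG'G) (by rw [h3, map_zero])
  -- the coefficient function, refined to slot-and-place colours
  refine ⟨placeRefine φ ax, ?_, fun U η hU => ?_⟩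
  · rw [← hcax]
    have hx : (fun jr : (Fin n × (Fin hA ⊕ Fin h)) × Fin 2 => avLetters g v (jr.1.1, φ.symm (jr.1.2, jr.2))) =
        fun jr : (Fin n × (Fin hA ⊕ Fin h)) × Fin 2 => complexBetti.map (g jr.1.1).hom.hom.hom 1
          (Sum.elim
            (fun i => complexBetti.map (Motives.AbelianVariety.fst A S).hom.hom.hom 1
              (ofRatClassBaseChange (Motives.ComplexPoints A.X) 1 (bA (i, jr.2))))
            (fun i => complexBetti.map (Motives.AbelianVariety.snd A S).hom.hom.hom 1
              (ofRatClassBaseChange (Motives.ComplexPoints S.X) 1 (cS (i, jr.2))))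
            jr.1.2) := by
      funext jr
      rw [avLetters_apply, hv_apply, Equiv.apply_symm_apply, hcbx]
      obtain ⟨⟨j, t⟩, r⟩ := jr
      rcases t with i | i
      · simp only [Sum.elim_inl]
        congr 1
        rw [hι₁, ← ofRatClassBaseChangeEquiv_apply (hX := hXP), ← ofRatClassBaseChangeEquiv_apply (hX := hXA),
          complexBetti_map_ofRatClassBaseChangeEquiv hXP hXA]
      · simp only [Sum.elim_inr]
        congr 1
        rw [hι₂, ← ofRatClassBaseChangeEquiv_apply (hX := hXP), ← ofRatClassBaseChangeEquiv_apply (hX := hXS),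
          complexBetti_map_ofRatClassBaseChangeEquiv hXP hXS]
    rw [← hx]
    exact wordEval_placeRefine _ φ (avLetters g v) ax
  · -- the blocks of `Y` placed by place kill the refined slices; read off the diagonal weights
    have h1 := wordDerAt_placeFamily_placeRefine_eq_zero φ D hax U
    have h2 : wordDerAt ℂ (fun t => Matrix.diagonal (δ₀ (U t).2)) (wordSlice (placeRefine φ ax) U) = 0 := h1
    have h3 := eq_zero_of_wordDerAt_diagonal_eq_zero (fun t => δ₀ (U t).2) h2 η (by
      have hsum_eq : ∑ t, δ₀ (U t).2 (η t) =
          ∑ t, Sum.elim (fun _ : Fin hA => if η t = 0 then (1 : ℂ) else -1) (fun _ : Fin h => (0 : ℂ)) (U t).2 := by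
        refine Finset.sum_congr rfl fun t _ => ?_
        rw [hδ₀]
        exact sum_elim_kindWeight_apply (U t).2 (η t)
      rw [hsum_eq]; exact hU)
    rw [wordSlice_apply] at h3
    exact h3


end Invariance

end Literature.AlgebraicGeometry.HodgeTheory

end
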